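import Mathlib
import Summits.Ventures.PercRepro.TriangleCapUpperZoneArith
import Summits.Ventures.PercRepro.TriangleCapStarFamilyNecessityUpper
import Summits.Ventures.PercRepro.TriangleCapZoneTwo

/-!
# PercRepro — THE TIGHT REGIME `D = 2 ρ + 1` ONE BELOW ITS THRESHOLD: `ρ + 1` INSIDE EDGES (p3, gen 57; part 337)

`D + 1 = 2 r`, `ρ = D − r = r − 1 ≥ 2`, `m = D + r − 3`, `t = m D + r`, `I = ρ + 1 = r`: the columns sum to
`t + r = (m + 1) D + 1` (residue `1`, `φ_D = D − 1`), the rows to `t − r = m D` (residue `0`).  A partial row costs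
`2 (D − 1)`.  Otherwise every row is empty or full, so exactly `m` rows are active, and an inside edge `y y'` has
`c(y) + c(y') ≤ m + (I + 1) = 2 D − 1`: EVERY INSIDE EDGE HAS A PARTIAL END.  Two distinct partial columns cost
`3 D − 5` (`column_loss_one`, part 334); a single one `z` carries every inside edge, so `r = I ≤ inDeg z ≤ c(z)`,
while its residue forces `c(z) = 1` — impossible for `r ≥ 3`.  Hence
`t (t − 1) + (4 D − 6) ≤ 2 j + 2 t (D − 1)` (`upper_zone_I_succ_tight`; `4 D − 6 = 8 ρ − 2`).  Axioms: standard.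
-/

namespace PercRepro

namespace TriangleCap

namespace C047

open Finset

variable {V : Type*} [Fintype V] [DecidableEq V]

/-- If every inside edge contains the non-neighbour `z`, the inside edges number at most `inDeg z`. -/
theorem card_insideEdges_le_inDeg (H : SimpleGraph V) [DecidableRel H.Adj] (w z : V)
    (hall : ∀ e ∈ insideEdges H w, z ∈ e) : (insideEdges H w).card ≤ inDeg H w z := by
  unfold inDeg
  have hsub : insideEdges H w ⊆ ((nonNbrs H w).filter (fun y => H.Adj z y)).image (fun y => s(z, y)) := by
    intro e he
    have hze := hall e he
    rw [mem_insideEdges, mem_offEdges] at he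
    obtain ⟨⟨h1, h2⟩, h3⟩ := he
    obtain ⟨u, v, rfl⟩ : ∃ u v, e = s(u, v) := Sym2.ind (fun u v => ⟨u, v, rfl⟩) e
    rw [SimpleGraph.mem_edgeFinset, SimpleGraph.mem_edgeSet] at h1
    rw [mem_image]
    rw [Sym2.mem_iff] at hze
    have hu : u ∈ nonNbrs H w := by
      rw [mem_nonNbrs]
      exact ⟨fun h => h2 (by rw [← h]; exact Sym2.mem_mk_left u v), h3 u (Sym2.mem_mk_left u v)⟩
    have hv : v ∈ nonNbrs H w := by
      rw [mem_nonNbrs]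
      exact ⟨fun h => h2 (by rw [← h]; exact Sym2.mem_mk_right u v), h3 v (Sym2.mem_mk_right u v)⟩
    rcases hze with h | h
    · refine ⟨v, mem_filter.mpr ⟨hv, by rw [h]; exact h1⟩, by rw [h]⟩
    · refine ⟨u, mem_filter.mpr ⟨hu, by rw [h]; exact H.adj_symm h1⟩, by rw [h]; exact Sym2.eq_swap⟩
  exact le_trans (card_le_card hsub) card_image_le

/-- **`ρ + 1` INSIDE EDGES IN THE TIGHT REGIME:** for `D + 1 = 2 r`, `r + 2 ≤ D`, `m + 3 = D + r`, `t = m D + r`,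
every triangle-free `H` with `s` edges, `w` of degree `s − t ≥ 1`, every off-degree `≤ D`, at the band value `2 j`
with `I = r` inside edges has `t (t − 1) + (4 D − 6) ≤ 2 j + 2 t (D − 1)`. -/
theorem upper_zone_I_succ_tight (H : SimpleGraph V) [DecidableRel H.Adj] (hfree : H.CliqueFree 3) (s m r D j : ℕ)
    (h1 : D + 1 = 2 * r) (h2 : r + 2 ≤ D) (hm : m + 3 = D + r) (hs : H.edgeFinset.card = s) (w : V)
    (hw : deg H w + (m * D + r) = s) (hw1 : 1 ≤ deg H w)
    (hj : ∑ v, deg H v * deg H v + 2 * ((m * D + r) * (s - (m * D + r) - 1)) + 2 * j = s * (s + 1))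
    (hD : ∀ v, offDeg H w v ≤ D) (hI : (insideEdges H w).card = r) :
    (m * D + r) * (m * D + r - 1) + (4 * D - 6) ≤ 2 * j + 2 * ((m * D + r) * (D - 1)) := by
  set t := m * D + r with ht
  have hD0 : 0 < D := by omega
  have hD3 : 3 ≤ D := by omega
  have hr3 : 3 ≤ r := by omega
  have hdef := deficiency_identity_split H hfree s t j D hs w hw hw1 hj hD
  have hoff : (offEdges H w).card = t := by
    have := card_offEdges_add_deg H w
    omega
  have hatt := attach_add_card_inside H hfree w
  rw [hoff] at hatt
  have hsumcol := sum_offDeg_nonNbrs_eq_add_card_inside H hfree w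
  rw [hoff] at hsumcol
  have hsumrow : ∑ y ∈ univ.filter (fun y => H.Adj w y), offDeg H w y = t - (insideEdges H w).card := by
    unfold attach at hatt
    omega
  rw [hI] at hdef hsumcol hsumrow
  have hcol := sum_mul_sub_ge_phi (nonNbrs H w) (offDeg H w) D (fun x _ => hD x)
  rw [hsumcol] at hcol
  have eplus : t + r = D * (m + 1) + 1 := by
    have : D * (m + 1) = m * D + D := by ring
    omega
  have eminus : t - r = D * m := by rw [ht, Nat.mul_comm D m]; omega
  rw [eplus, phiD_mul_add, phiD_of_lt D 1 (by omega), one_mul] at hcol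
  have hmodcol : (∑ z ∈ nonNbrs H w, offDeg H w z) % D = 1 := by
    rw [hsumcol, eplus, Nat.mul_add_mod, Nat.mod_eq_of_lt (by omega)]
  have hmodrow : (∑ y ∈ univ.filter (fun y => H.Adj w y), offDeg H w y) % D = 0 := by
    rw [hsumrow, eminus, Nat.mul_mod_right]
  -- a partial row, or every row empty or full
  by_cases hPr : ∃ y ∈ univ.filter (fun y => H.Adj w y), 1 ≤ offDeg H w y ∧ offDeg H w y + 1 ≤ D
  · obtain ⟨y, hy, hy1, hyD⟩ := hPr
    have hloss := column_loss_zero (univ.filter (fun y => H.Adj w y)) (offDeg H w) D (by omega) (fun y _ => hD y)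
      y hy hy1 hyD hmodrow
    omega
  · have hrows0 : ∀ y ∈ univ.filter (fun y => H.Adj w y), offDeg H w y = 0 ∨ offDeg H w y = D := by
      intro y hy
      have := hD y
      by_contra hne
      rw [not_or] at hne
      exact hPr ⟨y, hy, by omega, by omega⟩
    -- exactly `m` active rows
    have hfull : (univ.filter (fun y => H.Adj w y ∧ offDeg H w y = D)).card = m := by
      have hsum := sum_eq_mul_card_of_zero_or (univ.filter (fun y => H.Adj w y)) (offDeg H w) D hrows0
      rw [hsumrow, filter_filter, eminus] at hsum
      exact (Nat.eq_of_mul_eq_mul_left hD0 hsum).symm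
    have hactive : (univ.filter (fun y => H.Adj w y ∧ 1 ≤ offDeg H w y)).card = m := by
      rw [← hfull]
      congr 1
      apply filter_congr
      intro y _
      constructor
      · rintro ⟨ha, ha'⟩
        refine ⟨ha, ?_⟩
        rcases hrows0 y (mem_filter.mpr ⟨mem_univ _, ha⟩) with h | h
        · omega
        · exact h
      · rintro ⟨ha, ha'⟩
        exact ⟨ha, by omega⟩
    -- every inside edge has a partial end
    have hedge : ∀ y ∈ nonNbrs H w, ∀ y' ∈ nonNbrs H w, H.Adj y y' →
        (1 ≤ offDeg H w y ∧ offDeg H w y + 1 ≤ D) ∨ (1 ≤ offDeg H w y' ∧ offDeg H w y' + 1 ≤ D) := by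
      intro y hy y' hy' hyy'
      have hnb := nbrDeg_add_nbrDeg_le_active H hfree w y y' hy hy' hyy'
      rw [hactive] at hnb
      have hin := inDeg_add_inDeg_le_inside_succ H w y y' hy hy' hyy'
      rw [hI] at hin
      have hcy := offDeg_eq_nbrDeg_add_inDeg H w y hy
      have hcy' := offDeg_eq_nbrDeg_add_inDeg H w y' hy'
      have hin1 : 1 ≤ inDeg H w y := by
        unfold inDeg
        exact card_pos.mpr ⟨y', mem_filter.mpr ⟨hy', hyy'⟩⟩
      have hin1' : 1 ≤ inDeg H w y' := by
        unfold inDeg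
        exact card_pos.mpr ⟨y, mem_filter.mpr ⟨hy, H.adj_symm hyy'⟩⟩
      have := hD y
      have := hD y'
      omega
    set P := (nonNbrs H w).filter (fun x => 1 ≤ offDeg H w x ∧ offDeg H w x + 1 ≤ D) with hP
    rcases Nat.lt_or_ge P.card 2 with hP2 | hP2
    swap
    · -- two partial columns: the column loss at the residue `1`
      obtain ⟨z, hz, z', hz', hne⟩ := one_lt_card.mp hP2
      rw [hP, mem_filter] at hz hz'
      have hloss := column_loss_one (nonNbrs H w) (offDeg H w) D hD3 (fun x _ => hD x) z z' hz.1 hz'.1 hne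
        hz.2.1 hz.2.2 hz'.2.1 hz'.2.2 hmodcol
      omega
    · exfalso
      -- at most one partial column: it is the end of the inside edge `x x'`, hence unique
      obtain ⟨x, hx, x', hx', hxx'⟩ := exists_adj_nonNbrs H w (by omega)
      have hz : ∃ z ∈ P, True := by
        rcases hedge x hx x' hx' hxx' with h | h
        · exact ⟨x, mem_filter.mpr ⟨hx, h⟩, trivial⟩
        · exact ⟨x', mem_filter.mpr ⟨hx', h⟩, trivial⟩
      obtain ⟨z, hzP, -⟩ := hz
      have hcard : P.card = 1 := by
        have := card_pos.mpr ⟨z, hzP⟩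
        omega
      obtain ⟨z₀, hz₀⟩ := card_eq_one.mp hcard
      have hzz : z = z₀ := by
        rw [hz₀, mem_singleton] at hzP
        exact hzP
      subst hzz
      rw [hP, mem_filter] at hzP
      -- the other columns are empty or full, so `c(z) ≡ 1 (mod D)`: `c(z) = 1`
      have hothers : ∀ x ∈ (nonNbrs H w).erase z, offDeg H w x = 0 ∨ offDeg H w x = D := by
        intro x hx
        rw [mem_erase] at hx
        by_contra hne
        rw [not_or] at hne
        have hxP : x ∈ P := by
          rw [hP, mem_filter]
          exact ⟨hx.2, by omega, by have := hD x; omega⟩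
        rw [hz₀, mem_singleton] at hxP
        exact hx.1 hxP
      have hsum := sum_eq_mul_card_of_zero_or ((nonNbrs H w).erase z) (offDeg H w) D hothers
      have hsplit := sum_erase_add (nonNbrs H w) (offDeg H w) hzP.1
      rw [hsum] at hsplit
      have hcz : offDeg H w z = 1 := by
        have hm' := hmodcol
        rw [← hsplit, Nat.mul_add_mod, Nat.mod_eq_of_lt (by omega : offDeg H w z < D)] at hm'
        exact hm'
      -- every inside edge contains `z`
      have hall : ∀ e ∈ insideEdges H w, z ∈ e := by
        intro e he
        rw [mem_insideEdges, mem_offEdges] at he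
        obtain ⟨⟨h1, h2⟩, h3⟩ := he
        obtain ⟨u, v, rfl⟩ : ∃ u v, e = s(u, v) := Sym2.ind (fun u v => ⟨u, v, rfl⟩) e
        rw [SimpleGraph.mem_edgeFinset, SimpleGraph.mem_edgeSet] at h1
        have hu : u ∈ nonNbrs H w := by
          rw [mem_nonNbrs]
          exact ⟨fun h => h2 (by rw [← h]; exact Sym2.mem_mk_left u v), h3 u (Sym2.mem_mk_left u v)⟩
        have hv : v ∈ nonNbrs H w := by
          rw [mem_nonNbrs]
          exact ⟨fun h => h2 (by rw [← h]; exact Sym2.mem_mk_right u v), h3 v (Sym2.mem_mk_right u v)⟩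
        rw [Sym2.mem_iff]
        rcases hedge u hu v hv h1 with h | h
        · have huP : u ∈ P := mem_filter.mpr ⟨hu, h⟩
          rw [hz₀, mem_singleton] at huP
          exact Or.inl huP.symm
        · have hvP : v ∈ P := mem_filter.mpr ⟨hv, h⟩
          rw [hz₀, mem_singleton] at hvP
          exact Or.inr hvP.symm
      have hle := card_insideEdges_le_inDeg H w z hall
      have hcz' := offDeg_eq_nbrDeg_add_inDeg H w z hzP.1
      omega

end C047

end TriangleCap

end PercRepro
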